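import Summits.ValiantsHypothesis.ValiantsHypothesis.Theorems.EquivariantDialPolyPermifyHookArith
import Literature.NumberTheory.DiophantineGeometry.SymmetricGroupRepsSignTwist
import Literature.NumberTheory.DiophantineGeometry.StandardTableauxDichotomy
import HarnessLib

/-!
# Equivariant dial — polynomial permify, file B: commuting row/column pairs of polynomial co-volume

Offer O-L1-29 «POLYNOMIAL PERMIFY» (decomposition workshop, lineage `decomp-val-lens-1`, g37;
RULING bus 3382), file B of five.

**Main theorem** (`exists_commuting_pair`). For every partition `μ ⊢ n` there are subgroups
`R ≤ R_μ` (row stabilizer) and `C ≤ C_μ` (column stabilizer) of `𝔖_n` which COMMUTE elementwise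
and satisfy the explicit co-volume law

  `n! ≤ (f^μ)^4 · |R| · |C|`,   `f^μ = numStandardTableaux μ`.

**Construction (greedy peeling).** Strong induction on `n`. If the first row is at least as long
as the first column (`μ'_1 ≤ μ_1 =: a`), write `μ = (a, ν)` with `ν ⊢ j = n - a`
(`exists_sortedParts_eq_sup_cons`), take the pair `(R₀, C₀)` for `ν` and put
`R := 𝔖_a × R₀`, `C := 1 × C₀` along the embedding `𝔖_a × 𝔖_j ↪ 𝔖_n` given by the row-reading
numbering (the first `a` entries form row `0`; entry `a + w` sits in the box of `w` in `ν`, one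
row lower). The co-volume law follows from the peeled hook length formula
`f^μ · (∏_{s<a} ((a-s) + ν'_s)) · j! = n! · f^ν` (`numStandardTableaux_mul_prod_firstRow`) and the
hook inequality (⋆G₄) of file A (`firstRow_hook_pow_four_le`, with `u_s = ν'_s`, `u_0 + 1 = μ'_1 ≤ a`).
Otherwise the transpose `μᵀ` is oriented; run the step there and conjugate by the transposing
permutation `π_μ` (`mem_rowStabilizer_transpose_iff`, `mem_colStabilizer_transpose_iff`), which
swaps the roles of `R` and `C`; `f^{μᵀ} = f^μ` by `spechtIdealTransposeEquiv`.

HONEST BOUNDARY: 0 S-currency; closes NO item; infrastructure for O-L1-29 (RULING bus 3382);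
pure `𝔖_n`-combinatorics — no dial claim is made in this file; stmt-23702 / VP ≠ VNP untouched.

References: hook length formula [cite: FrameRobinsonThrallCJM1954, Theorem 1]; Young subgroups and
Specht modules [cite: JamesKerber1981, 1.5 and 7.1]; the orbit-closure / symmetry context of the
dial [cite: LandsbergRessayre2017, Theorem 2.5.5] [cite: DawarWilsenach2025, Theorem 2].
Theorems only; no definitions.
-/

set_option linter.dupNamespace false

namespace Summit.ValiantsHypothesis.ValiantsHypothesis.Theorems.EquivariantDialPolyPermify

open Literature.NumberTheory.DiophantineGeometry

/-! ### The row-reading numbering of `μ = (a, ν)` -/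

section Peel

variable {n j a : ℕ} {μ : Nat.Partition n} {ν : Nat.Partition j}

/-- The first `a` entries of the row-reading tableau of `μ = (a, ν)` lie in row `0`. [folklore] -/
theorem rowOf_eq_zero_of_lt (hs : μ.sortedParts = a :: ν.sortedParts) (x : Fin n)
    (hx : (x : ℕ) < a) : μ.rowOf x = 0 := by
  apply μ.rowOf_eq_of_le_of_lt x
  · rw [hs, List.length_cons]; omega
  · simp
  · rw [hs]; simpa using hx

/-- … and entry `i < a` sits in column `i`. [folklore] -/
theorem colOf_eq_val_of_lt (hs : μ.sortedParts = a :: ν.sortedParts) (x : Fin n)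
    (hx : (x : ℕ) < a) : μ.colOf x = x := by
  simp [Nat.Partition.colOf, rowOf_eq_zero_of_lt hs x hx]

/-- Entry `a + w` of `μ = (a, ν)` lies one row below entry `w` of `ν`. [folklore] -/
theorem rowOf_eq_succ_of_val_eq (hs : μ.sortedParts = a :: ν.sortedParts) (x : Fin n) (w : Fin j)
    (hx : (x : ℕ) = a + w) : μ.rowOf x = ν.rowOf w + 1 := by
  apply μ.rowOf_eq_of_le_of_lt x
  · rw [hs, List.length_cons]; have := ν.rowOf_lt_length w; omega
  · rw [hs, List.take_succ_cons, List.sum_cons, hx]; have := ν.sum_take_rowOf_le w; omega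
  · rw [hs, List.take_succ_cons, List.sum_cons, hx]; have := ν.lt_sum_take_rowOf_succ w; omega

/-- … and in the same column as entry `w` of `ν`. [folklore] -/
theorem colOf_eq_of_val_eq (hs : μ.sortedParts = a :: ν.sortedParts) (x : Fin n) (w : Fin j)
    (hx : (x : ℕ) = a + w) : μ.colOf x = ν.colOf w := by
  have h := rowOf_eq_succ_of_val_eq hs x w hx
  simp only [Nat.Partition.colOf, h, hs, List.take_succ_cons, List.sum_cons, hx]
  omega

end Peel

/-! ### Arithmetic of the co-volume law -/

/-- `(∏_{s<a} ((a - s) + j)) · j! = (a + j)!`. [folklore] -/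
theorem prod_firstRow_add_mul_factorial (a j : ℕ) :
    (∏ s ∈ Finset.range a, ((a - s) + j)) * j.factorial = (a + j).factorial := by
  induction a with
  | zero => simp
  | succ a ih =>
    rw [Finset.prod_range_succ']
    have h1 : ∀ s ∈ Finset.range a, (a + 1 - (s + 1) + j) = (a - s + j) := by
      intro s _; rw [Nat.add_sub_add_right]
    rw [Finset.prod_congr rfl h1, Nat.sub_zero, show a + 1 + j = (a + j) + 1 by ring,
      Nat.factorial_succ, ← ih]
    ring

/-- The co-volume bookkeeping of one peeling step: from the peeled hook length formula
`F · (P · J) = N · G`, the hook inequality `P⁴ ≤ A · Q³`, `Q · J = N` and the inductive law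
`J ≤ G⁴ · r · c` conclude `N ≤ F⁴ · (A · r) · c`. [folklore] -/
theorem covolume_step (N F G P Q A J r c : ℕ) (hN : 0 < N) (hG : 0 < G)
    (hook : F * (P * J) = N * G) (hG4 : P ^ 4 ≤ A * Q ^ 3) (hQ : Q * J = N)
    (hineq : J ≤ G ^ 4 * (r * c)) : N ≤ F ^ 4 * (A * r * c) := by
  have h1 : N ^ 3 * (N * G ^ 4) ≤ N ^ 3 * (F ^ 4 * (A * J)) := by
    calc N ^ 3 * (N * G ^ 4) = (N * G) ^ 4 := by ring
      _ = (F * (P * J)) ^ 4 := by rw [hook]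
      _ = F ^ 4 * P ^ 4 * J ^ 4 := by ring
      _ ≤ F ^ 4 * (A * Q ^ 3) * J ^ 4 := by gcongr
      _ = F ^ 4 * A * (Q * J) ^ 3 * J := by ring
      _ = N ^ 3 * (F ^ 4 * (A * J)) := by rw [hQ]; ring
  have h2 : N * G ^ 4 ≤ F ^ 4 * (A * J) := Nat.le_of_mul_le_mul_left h1 (by positivity)
  have h3 : G ^ 4 * N ≤ G ^ 4 * (F ^ 4 * (A * r * c)) := by
    calc G ^ 4 * N = N * G ^ 4 := by ring
      _ ≤ F ^ 4 * (A * J) := h2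
      _ ≤ F ^ 4 * (A * (G ^ 4 * (r * c))) := by gcongr
      _ = G ^ 4 * (F ^ 4 * (A * r * c)) := by ring
  exact Nat.le_of_mul_le_mul_left h3 (by positivity)

/-! ### The oriented peeling step -/

/-- **Peeling step (oriented shapes).** If `μ = (a, ν)` with `μ'_1 = ν'_0 + 1 ≤ a` and `ν` carries
a commuting pair `R₀ ≤ R_ν`, `C₀ ≤ C_ν` with `j! ≤ (f^ν)^4 |R₀| |C₀|`, then
`R := 𝔖_a × R₀`, `C := 1 × C₀` (embedded along the row-reading numbering) is a commuting pair for
`μ` with `n! ≤ (f^μ)^4 |R| |C|`. [cite: FrameRobinsonThrallCJM1954, Theorem 1] -/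
theorem pair_step_core {n j a : ℕ} (μ : Nat.Partition n) (ν : Nat.Partition j)
    (hs : μ.sortedParts = a :: ν.sortedParts) (hcol : ν.youngDiagram.colLen 0 + 1 ≤ a)
    (R₀ C₀ : Subgroup (Equiv.Perm (Fin j))) (hR₀ : R₀ ≤ rowStabilizer ν)
    (hC₀ : C₀ ≤ colStabilizer ν) (hRC₀ : ∀ r ∈ R₀, ∀ c ∈ C₀, r * c = c * r)
    (hineq : j.factorial ≤ numStandardTableaux ν ^ 4 * (Nat.card R₀ * Nat.card C₀)) :
    ∃ R C : Subgroup (Equiv.Perm (Fin n)), R ≤ rowStabilizer μ ∧ C ≤ colStabilizer μ ∧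
      (∀ r ∈ R, ∀ c ∈ C, r * c = c * r) ∧
      n.factorial ≤ numStandardTableaux μ ^ 4 * (Nat.card R * Nat.card C) := by
  have han : a + j = n := add_eq_of_sortedParts_eq_cons hs
  -- the row-reading embedding `𝔖_a × 𝔖_j ↪ 𝔖_n`
  let e : Fin a ⊕ Fin j ≃ Fin n := finSumFinEquiv.trans (finCongr han)
  have he₁ : ∀ i : Fin a, ((e (Sum.inl i) : Fin n) : ℕ) = i := by intro i; simp [e]
  have he₂ : ∀ w : Fin j, ((e (Sum.inr w) : Fin n) : ℕ) = a + w := by intro w; simp [e]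
  let Φ : Equiv.Perm (Fin a) × Equiv.Perm (Fin j) →* Equiv.Perm (Fin n) :=
    e.permCongrHom.toMonoidHom.comp (Equiv.Perm.sumCongrHom (Fin a) (Fin j))
  have hΦ : ∀ (p : Equiv.Perm (Fin a) × Equiv.Perm (Fin j)) (y : Fin a ⊕ Fin j),
      Φ p (e y) = e (Sum.map p.1 p.2 y) := by
    intro p y
    simp [Φ, Equiv.Perm.sumCongrHom, Equiv.permCongr_apply]
  have hΦinj : Function.Injective Φ := by
    intro p q h
    simp only [Φ, MonoidHom.coe_comp, Function.comp_apply, MulEquiv.coe_toMonoidHom] at h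
    exact Equiv.Perm.sumCongrHom_injective (e.permCongrHom.injective h)
  refine ⟨((⊤ : Subgroup (Equiv.Perm (Fin a))).prod R₀).map Φ,
    ((⊥ : Subgroup (Equiv.Perm (Fin a))).prod C₀).map Φ, ?_, ?_, ?_, ?_⟩
  · -- `𝔖_a × R₀` stabilizes the rows of `μ`
    rintro _ ⟨p, hp, rfl⟩
    rw [SetLike.mem_coe, Subgroup.mem_prod] at hp
    rw [mem_rowStabilizer_iff]
    intro x
    obtain ⟨y, rfl⟩ := e.surjective x
    rw [hΦ]
    cases y with
    | inl i =>
      rw [Sum.map_inl, rowOf_eq_zero_of_lt hs _ (by rw [he₁]; exact (p.1 i).isLt),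
        rowOf_eq_zero_of_lt hs _ (by rw [he₁]; exact i.isLt)]
    | inr w =>
      rw [Sum.map_inr, rowOf_eq_succ_of_val_eq hs _ (p.2 w) (he₂ _),
        rowOf_eq_succ_of_val_eq hs _ w (he₂ _), (mem_rowStabilizer_iff ν p.2).mp (hR₀ hp.2) w]
  · -- `1 × C₀` stabilizes the columns of `μ`
    rintro _ ⟨p, hp, rfl⟩
    rw [SetLike.mem_coe, Subgroup.mem_prod] at hp
    have hp1 : p.1 = 1 := Subgroup.mem_bot.mp hp.1
    rw [mem_colStabilizer_iff]
    intro x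
    obtain ⟨y, rfl⟩ := e.surjective x
    rw [hΦ]
    cases y with
    | inl i => rw [Sum.map_inl, hp1, Equiv.Perm.one_apply]
    | inr w =>
      rw [Sum.map_inr, colOf_eq_of_val_eq hs _ (p.2 w) (he₂ _),
        colOf_eq_of_val_eq hs _ w (he₂ _), (mem_colStabilizer_iff ν p.2).mp (hC₀ hp.2) w]
  · -- the two factors commute
    rintro _ ⟨p, hp, rfl⟩ _ ⟨q, hq, rfl⟩
    rw [SetLike.mem_coe, Subgroup.mem_prod] at hp hq
    have hq1 : q.1 = 1 := Subgroup.mem_bot.mp hq.1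
    rw [← map_mul, ← map_mul]
    congr 1
    exact Prod.ext (by rw [Prod.fst_mul, Prod.fst_mul, hq1, mul_one, one_mul])
      (by rw [Prod.snd_mul, Prod.snd_mul]; exact hRC₀ _ hp.2 _ hq.2)
  · -- the co-volume law
    have hcardR : Nat.card (((⊤ : Subgroup (Equiv.Perm (Fin a))).prod R₀).map Φ) =
        a.factorial * Nat.card R₀ := by
      rw [Subgroup.card_map_of_injective hΦinj,
        Nat.card_congr (Subgroup.prodEquiv ⊤ R₀).toEquiv, Nat.card_prod, Subgroup.card_top,
        Nat.card_eq_fintype_card, Fintype.card_perm, Fintype.card_fin]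
    have hcardC : Nat.card (((⊥ : Subgroup (Equiv.Perm (Fin a))).prod C₀).map Φ) =
        Nat.card C₀ := by
      rw [Subgroup.card_map_of_injective hΦinj,
        Nat.card_congr (Subgroup.prodEquiv ⊥ C₀).toEquiv, Nat.card_prod, Subgroup.card_bot,
        one_mul]
    rw [hcardR, hcardC]
    -- the hook inequality (⋆G₄) with `u_s = ν'_s`
    have hanti : Antitone ν.youngDiagram.colLen := fun s t hst =>
      ν.youngDiagram.colLen_anti s t hst
    have hsum : ∑ s ∈ Finset.range a, ν.youngDiagram.colLen s ≤ j := by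
      calc ∑ s ∈ Finset.range a, ν.youngDiagram.colLen s
          ≤ ∑ s ∈ Finset.range (max a j), ν.youngDiagram.colLen s :=
            Finset.sum_le_sum_of_subset_of_nonneg (Finset.range_mono (le_max_left a j))
              (fun _ _ _ => Nat.zero_le _)
        _ = j := sum_range_colLen_youngDiagram ν (le_max_right a j)
    have hG4 := firstRow_hook_pow_four_le a j ν.youngDiagram.colLen hanti hcol hsum
    rw [prod_range_self_sub_eq_factorial] at hG4
    have hook := numStandardTableaux_mul_prod_firstRow hs
    have hQ : (∏ s ∈ Finset.range a, ((a - s) + j)) * j.factorial = n.factorial := by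
      rw [← han]; exact prod_firstRow_add_mul_factorial a j
    exact covolume_step n.factorial (numStandardTableaux μ) (numStandardTableaux ν) _ _ _ _
      _ _ (Nat.factorial_pos _) (numStandardTableaux_pos_holds ν) hook hG4 hQ hineq

/-- **Peeling step** for an oriented shape (`μ'_1 ≤ μ_1`), from the inductive hypothesis below `n`.
[cite: FrameRobinsonThrallCJM1954, Theorem 1] -/
theorem pair_step {n : ℕ} (μ : Nat.Partition n) (hn : n ≠ 0)
    (horient : μ.youngDiagram.colLen 0 ≤ μ.parts.sup)
    (IH : ∀ j < n, ∀ ν : Nat.Partition j, ∃ R C : Subgroup (Equiv.Perm (Fin j)),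
      R ≤ rowStabilizer ν ∧ C ≤ colStabilizer ν ∧ (∀ r ∈ R, ∀ c ∈ C, r * c = c * r) ∧
      j.factorial ≤ numStandardTableaux ν ^ 4 * (Nat.card R * Nat.card C)) :
    ∃ R C : Subgroup (Equiv.Perm (Fin n)), R ≤ rowStabilizer μ ∧ C ≤ colStabilizer μ ∧
      (∀ r ∈ R, ∀ c ∈ C, r * c = c * r) ∧
      n.factorial ≤ numStandardTableaux μ ^ 4 * (Nat.card R * Nat.card C) := by
  obtain ⟨ν, hs⟩ := exists_sortedParts_eq_sup_cons μ hn
  have han : μ.parts.sup + (n - μ.parts.sup) = n := add_eq_of_sortedParts_eq_cons hs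
  have ha0 : 0 < μ.parts.sup := μ.pos_of_mem_sortedParts (by rw [hs]; simp)
  have H := sortedGE_cons_of_sortedParts_eq hs
  have hcol0 : μ.youngDiagram.colLen 0 = ν.youngDiagram.colLen 0 + 1 := by
    rw [youngDiagram_eq_ofRowLens_cons hs H]
    exact colLen_ofRowLens_cons H ν.sortedGE_sortedParts ha0
  obtain ⟨R₀, C₀, hR₀, hC₀, hRC₀, hineq⟩ := IH (n - μ.parts.sup) (by omega) ν
  exact pair_step_core μ ν hs (by omega) R₀ C₀ hR₀ hC₀ hRC₀ hineq

/-! ### Transport through the transpose -/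

/-- A commuting pair for `μᵀ` conjugates (by the transposing permutation `π_μ`, with the roles of
rows and columns exchanged) to a commuting pair for `μ` of the same co-volume; `f^{μᵀ} = f^μ` via
`S^μ ≃ S^{μᵀ}` over `ℂ` (`spechtIdealTransposeEquiv`) and `dim S^μ = f^μ` (the tree's
`SymPencilEquivariantSdcNotQP….numStandardTableaux_transpose`, re-derived inline to keep the import
set minimal). [cite: JamesKerber1981, 1.5 and 7.1] -/
theorem pair_transpose {n : ℕ} (μ : Nat.Partition n) (R C : Subgroup (Equiv.Perm (Fin n)))
    (hR : R ≤ rowStabilizer μ.transpose) (hC : C ≤ colStabilizer μ.transpose)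
    (hRC : ∀ r ∈ R, ∀ c ∈ C, r * c = c * r)
    (hineq : n.factorial ≤ numStandardTableaux μ.transpose ^ 4 * (Nat.card R * Nat.card C)) :
    ∃ R' C' : Subgroup (Equiv.Perm (Fin n)), R' ≤ rowStabilizer μ ∧ C' ≤ colStabilizer μ ∧
      (∀ r ∈ R', ∀ c ∈ C', r * c = c * r) ∧
      n.factorial ≤ numStandardTableaux μ ^ 4 * (Nat.card R' * Nat.card C') := by
  let κ : Equiv.Perm (Fin n) →* Equiv.Perm (Fin n) :=
    (MulAut.conj μ.transposePerm⁻¹).toMonoidHom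
  have hκ : ∀ x, κ x = μ.transposePerm⁻¹ * x * μ.transposePerm := by
    intro x; simp [κ]
  have hκinj : Function.Injective κ := by
    intro x y h
    rw [hκ, hκ] at h
    simpa using h
  refine ⟨C.map κ, R.map κ, ?_, ?_, ?_, ?_⟩
  · rintro _ ⟨c, hc, rfl⟩
    rw [hκ]
    exact (mem_colStabilizer_transpose_iff μ c).mp (hC hc)
  · rintro _ ⟨r, hr, rfl⟩
    rw [hκ]
    exact (mem_rowStabilizer_transpose_iff μ r).mp (hR hr)
  · rintro _ ⟨c, hc, rfl⟩ _ ⟨r, hr, rfl⟩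
    rw [← map_mul, ← map_mul, hRC r hr c hc]
  · have hf : numStandardTableaux μ.transpose = numStandardTableaux μ := by
      rw [← finrank_spechtIdeal_holds (k := ℂ) μ, ← finrank_spechtIdeal_holds (k := ℂ) μ.transpose]
      exact (spechtIdealTransposeEquiv ℂ μ).finrank_eq.symm
    rw [Subgroup.card_map_of_injective hκinj, Subgroup.card_map_of_injective hκinj, ← hf,
      mul_comm (Nat.card C)]
    exact hineq

/-! ### The main theorem -/

/-- **Commuting row/column pairs of polynomial co-volume.** For every `μ ⊢ n` there are
elementwise commuting subgroups `R ≤ R_μ`, `C ≤ C_μ` of `𝔖_n` with `n! ≤ (f^μ)^4 · |R| · |C|`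
(greedy peeling of the longer of first row / first column; hook length formula).
[cite: FrameRobinsonThrallCJM1954, Theorem 1] [cite: JamesKerber1981, 1.5 and 7.1] -/
theorem exists_commuting_pair {n : ℕ} (μ : Nat.Partition n) :
    ∃ R C : Subgroup (Equiv.Perm (Fin n)), R ≤ rowStabilizer μ ∧ C ≤ colStabilizer μ ∧
      (∀ r ∈ R, ∀ c ∈ C, r * c = c * r) ∧
      n.factorial ≤ numStandardTableaux μ ^ 4 * (Nat.card R * Nat.card C) := by
  revert μ
  induction n using Nat.strong_induction_on with
  | _ n IH =>
    intro μ
    rcases eq_or_ne n 0 with hn | hn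
    · subst hn
      refine ⟨⊥, ⊥, bot_le, bot_le, ?_, ?_⟩
      · intro r hr c hc
        rw [Subgroup.mem_bot] at hr hc
        rw [hr, hc]
      · rw [Subgroup.card_bot, Nat.factorial_zero, mul_one, mul_one]
        exact Nat.one_le_pow _ _ (numStandardTableaux_pos_holds μ)
    · rcases le_or_gt (μ.youngDiagram.colLen 0) μ.parts.sup with h | h
      · exact pair_step μ hn h IH
      · have h' : μ.transpose.youngDiagram.colLen 0 ≤ μ.transpose.parts.sup := by
          rw [← sup_parts_transpose_eq_colLen_zero, μ.transpose_transpose,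
            sup_parts_transpose_eq_colLen_zero]
          exact h.le
        obtain ⟨R, C, hR, hC, hRC, hineq⟩ := pair_step μ.transpose hn h' IH
        exact pair_transpose μ R C hR hC hRC hineq

end Summit.ValiantsHypothesis.ValiantsHypothesis.Theorems.EquivariantDialPolyPermify
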